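import Summits.ResolutionOfSingularities.ResolutionOfSingularities.Theorems.FrobeniusLadderFRationalModificationMaxMultiplicityCertificate
import Summits.ResolutionOfSingularities.ResolutionOfSingularities.Theorems.FrobeniusLadderFRationalModificationCertifiedModel
import Summits.ResolutionOfSingularities.ResolutionOfSingularities.Theorems.FrobeniusLadderFRationalResolutionStubClauseOfRingEquiv
import Literature.AlgebraicGeometry.Resolution.BlowupsExistence
import Literature.AlgebraicGeometry.Resolution.BlowupsIntegral
import Literature.AlgebraicGeometry.Resolution.BlowupsProperProofs
import Literature.AlgebraicGeometry.Resolution.BlowupsFlatBaseChange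
import Literature.AlgebraicGeometry.Resolution.ProOpenIdealExtension
import Literature.AlgebraicGeometry.Resolution.HilbertSamuelIsolatedSingularities
import Mathlib.AlgebraicGeometry.FunctionField
import HarnessLib

/-!
# A finite defect of isolated maximal-multiplicity F-pure hypersurface points is resolved to rung 3 by
# one blowing up (crux `FrobeniusLadder.FRationalModification`, line `socle-discrepancy-certificate`, wave 3)

Support file for crux stmt-ResolutionOfSingularities-15316 (`FrobeniusLadder.FRationalModification`, route
`ResolutionOfSingularities/FrobeniusLadder`), line `socle-discrepancy-certificate`, registered sub-goal
`finiteMaxMultDefect_model` — THE CANONICAL GLOBAL STEP, the first unconditional producer instance of the crux's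
conclusion above dimension one.

Let `Y` be an integral separated `k`-scheme of finite type (`char k = p`) whose non-F-rational locus (the set `T`
of points whose local ring fails the route's rung-3 clause "domain, every ideal generated by a system of parameters
tightly closed") is a FINITE set of CLOSED points, each an isolated singularity `𝒪_{Y,x} ≅ S/(f)` of
maximal-multiplicity F-pure hypersurface type (`S` regular local of dimension `n+1`, `f ∈ 𝔪^{n+1}`,
`f^{p-1} ∉ 𝔪^[p]`). Then `Y` has a proper birational model all of whose local rings are rung-3:

* the centre is `T` with its reduced structure, `J = 𝓘_T` (Mathlib's `IdealSheafData.vanishingIdeal`); it is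
  non-zero because points of `T` are singular (regular local rings are rung-3, `Negative.rungThree_of_isRegularLocalRing`)
  and the regular locus of the integral `Y` is dense (`vanishingIdeal_ne_bot_of_subset_compl_regularLocus`);
* `π : W → Y` is a blowing up along `J` (`exists_isBlowup`, Görtz–Wedhorn Prop. 13.92): proper (Stacks 02NS,
  `IsBlowup.isProper`), birational and with integral source (Stacks 02ND, `IsBlowup.isBirational'`, `isIntegral`);
* off `T` the blowing up is a local isomorphism (Stacks 02OS, `IsBlowup.isIso_compl`), and the rung-3 clause is
  invariant under ring isomorphisms (`ClauseInvariance.stub_clause_of_ringEquiv`);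
* over `x ∈ T`: blowing up commutes with the flat base change `Spec 𝒪_{Y,x} → Y` (Görtz–Wedhorn Prop. 13.91 (2),
  `IsBlowup.pullback_snd_of_flat`), the pulled-back centre is `(J_x)~ = (𝔪_x)~` (`comap_fromSpecStalk_eq_idealSheaf`,
  `stalkIdeal_vanishingIdeal_of_finite`), so by uniqueness of blowing ups the stalks of `W` over `x` are stalks of
  `Bl_{𝔪_x}(Spec 𝒪_{Y,x}) = affineBlowup (maximalIdeal 𝒪_{Y,x})` (`exists_stalk_ringEquiv_affineBlowup`), where
  S1 `MaxMultiplicityCertificate.stub_maxMultiplicityCertificate` certifies every point (regular, or a domain with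
  `t ∈ 𝔪 ∖ 0`, `𝒪[1/t]` regular, `𝒪/(t)` Cohen–Macaulay with Frobenius-closed parameter ideals), and certified
  stalks of a `k`-scheme locally of finite type are rung-3 (`CertifiedModel.rungThree_of_certificate`).

* `comap_fromSpecStalk_eq_idealSheaf` — `(Spec 𝒪_{X,x} → X)⁻¹ J · 𝒪 = (J_x)~`;
* `exists_stalk_ringEquiv_affineBlowup` — stalks of a blowing up over `x` are stalks of `Bl_{J_x}(Spec 𝒪_{X,x})`;
* `isIso_stalkMap_of_not_mem_support` — off the centre a blowing up does not change the local rings;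
* `finiteMaxMultDefect_model` — the registered form, verbatim.

References: U. Görtz, T. Wedhorn, *Algebraic Geometry I* (2nd ed. 2020), Def. 13.90, Prop. 13.91, Prop. 13.92,
Prop. 13.96; The Stacks Project, Tags 02NS, 02OS, 02ND, 01J7; R. Fedder, Trans. AMS 278 (1983), Thm. 1.12;
R. Fedder, K.-i. Watanabe (1989), Prop. 2.13. [folklore]
-/

-- single-problem summit: the doubled namespace component `ResolutionOfSingularities` is forced
set_option linter.dupNamespace false

noncomputable section

open CategoryTheory CategoryTheory.Limits AlgebraicGeometry TopologicalSpace IsLocalRing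
open Literature.AlgebraicGeometry.Resolution Literature.RingTheory.TightClosure
open Summit.ResolutionOfSingularities.ResolutionOfSingularities.Theorems
open Summit.ResolutionOfSingularities.ResolutionOfSingularities.Theorems.FRationalModification

namespace Summit.ResolutionOfSingularities.ResolutionOfSingularities.Theorems.FRationalModification.FiniteMaxMultDefectModel

/-! ## §1 Stalks of a blowing up: over a point of the centre, and off the centre -/

/-- **The inverse image of an ideal sheaf along `Spec 𝒪_{X,x} → X` is the ideal sheaf of its stalk**:
`(Spec 𝒪_{X,x} → X)⁻¹ J · 𝒪 = (J_x)~`, written as the centre `affineBlowup.idealSheaf (stalkIdeal J x)` of the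
affine blowing up of `Spec 𝒪_{X,x}` along `J_x` (through `𝒪_{X,x} ≅ Γ(Spec 𝒪_{X,x}, ⊤)`).
[cite: StacksProject, Tag 01J7] -/
theorem comap_fromSpecStalk_eq_idealSheaf {X : Scheme.{0}} (J : X.IdealSheafData) (x : X) :
    J.comap (X.fromSpecStalk x) = affineBlowup.idealSheaf (stalkIdeal J x) := by
  -- adapted from `comap_fromSpecStalk_eq_ofIdealTop` (Literature/…/AlterationsNormalFormBlowupFormal.lean)
  obtain ⟨U, hU, hxU, -⟩ :=
    exists_isAffineOpen_mem_and_subset (X := X) (x := x) (U := ⊤) (Opens.mem_top x)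
  refine Scheme.IdealSheafData.ext_of_isAffine ?_
  rw [affineBlowup.idealSheaf, ideal_ofIdealTop_top, ideal_comap_of_le (X.fromSpecStalk x) J ⟨U, hU⟩
    ⟨⊤, isAffineOpen_top _⟩ (top_le_preimage_fromSpecStalk x U hxU), appLE_fromSpecStalk_top x U hxU,
    stalkIdeal_eq_map_germ J ⟨U, hU⟩ hxU, Ideal.map_map]
  rfl

/-- **Stalks of a blowing up at points over `x` are stalks of the blowing up of `Spec 𝒪_{X,x}` along `J_x`.**
For a blowing up `π : X' → X` along `J` (universal property, Görtz–Wedhorn Def. 13.90), an ideal `I = J_x` of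
`𝒪_{X,x}` and `w ∈ X'` over `x`: the base change `X' ×_X Spec 𝒪_{X,x} → Spec 𝒪_{X,x}` along the flat
`Spec 𝒪_{X,x} → X` is a blowing up along `(J_x)~` (Görtz–Wedhorn Prop. 13.91 (2)), hence isomorphic over
`Spec 𝒪_{X,x}` to `Bl_I(Spec 𝒪_{X,x}) = affineBlowup I` (Prop. 13.92 and uniqueness of blowing ups); `w` lifts to
a point of the fibre product, at which the projection to `X'` induces an isomorphism of local rings (a flat
preimmersion). [cite: GortzWedhorn2020, Prop. 13.91 (2)] -/
theorem exists_stalk_ringEquiv_affineBlowup {X' X : Scheme.{0}} {π : X' ⟶ X} {J : X.IdealSheafData}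
    (hπ : IsBlowup π J) {x : X} {I : Ideal (X.presheaf.stalk x)} (hI : stalkIdeal J x = I) {w : X'}
    (hw : π w = x) :
    ∃ y : ↥(affineBlowup I), Nonempty (X'.presheaf.stalk w ≃+* (affineBlowup I).presheaf.stalk y) := by
  subst hI
  haveI := flat_fromSpecStalk X x
  -- the base change to `Spec 𝒪_{X,x}` is the affine blowing up along `J_x`
  have hb : IsBlowup (pullback.snd π (X.fromSpecStalk x)) (affineBlowup.idealSheaf (stalkIdeal J x)) := by
    have h := hπ.pullback_snd_of_flat (X.fromSpecStalk x)
    rwa [comap_fromSpecStalk_eq_idealSheaf] at h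
  obtain ⟨e, -, -⟩ := hb.unique (affineBlowup.isBlowup (stalkIdeal J x))
  -- lift `w` to the fibre product
  obtain ⟨s, hs⟩ := mem_range_pullback_fst_fromSpecStalk_of_eq (π := π) (x := x) hw
  haveI := isIso_stalkMap_pullback_fst_fromSpecStalk π x s
  let e₁ : X'.presheaf.stalk (pullback.fst π (X.fromSpecStalk x) s) ≅
      (pullback π (X.fromSpecStalk x)).presheaf.stalk s :=
    asIso ((pullback.fst π (X.fromSpecStalk x)).stalkMap s)
  let e₂ : (affineBlowup (stalkIdeal J x)).presheaf.stalk (e.hom s) ≅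
      (pullback π (X.fromSpecStalk x)).presheaf.stalk s :=
    asIso (e.hom.stalkMap s)
  let e₀ : X'.presheaf.stalk (pullback.fst π (X.fromSpecStalk x) s) ≅ X'.presheaf.stalk w :=
    X'.presheaf.stalkCongr (.of_eq hs)
  exact ⟨e.hom s, ⟨((e₀.symm ≪≫ e₁) ≪≫ e₂.symm).commRingCatIsoToRingEquiv⟩⟩

/-- **Off the centre a blowing up does not change the local rings**: if `π w ∉ V(J)` then the stalk map
`𝒪_{X, π w} → 𝒪_{X', w}` is an isomorphism (`π` restricts to an isomorphism over `X ∖ V(J)`, Stacks 02OS).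
[cite: StacksProject, Tag 02OS] -/
theorem isIso_stalkMap_of_not_mem_support {X' X : Scheme.{0}} {π : X' ⟶ X} {J : X.IdealSheafData}
    (hπ : IsBlowup π J) (w : X') (hw : π w ∉ (J.support : Set X)) : IsIso (π.stalkMap w) := by
  haveI : IsIso (π ∣_ centreCompl J) := hπ.isIso_compl
  exact isIso_stalkMap_of_isIso_morphismRestrict π (centreCompl J) w hw

/-! ## §2 The canonical global step -/

/-- W3a — **THE CANONICAL GLOBAL STEP** (registered sub-goal `finiteMaxMultDefect_model` of crux
stmt-ResolutionOfSingularities-15316, line `socle-discrepancy-certificate`; first unconditional producer instance of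
the crux's conclusion above dimension 1): an integral separated finite-type rung-2 `Y/k` whose defect is a finite
set `T` of closed points, each an isolated singularity of maximal-multiplicity F-pure hypersurface type, has a
proper birational model with rung-3 stalks — blow up `T`: over `x ∈ T` the stalks are stalks of
`Bl_𝔪 Spec 𝒪_{Y,x}`, certified by `MaxMultiplicityCertificate.stub_maxMultiplicityCertificate`, and certificates
give rung 3 by `CertifiedModel.rungThree_of_certificate`; off `T` nothing changes. (The rung-2 hypothesis `h₂` is part
of the registered signature but is not used.) [cite: Fedder1983, Thm. 1.12; GortzWedhorn2020, Prop. 13.91] -/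
theorem finiteMaxMultDefect_model
    (p : ℕ) [Fact p.Prime] (k : Type) [Field k] [CharP k p] (Y : Scheme.{0}) (g : Y ⟶ Spec (.of k))
    [IsSeparated g] [LocallyOfFiniteType g] [QuasiCompact g] [IsIntegral Y] (h₂ : ∀ y : Y, IsDomain
    (Y.presheaf.stalk y) ∧ ∀ d : ℕ, ringKrullDim (Y.presheaf.stalk y) = d → ∀ s : Fin d → Y.presheaf.stalk
    y, (Ideal.span (Set.range s)).radical.IsMaximal → RingTheory.Sequence.IsWeaklyRegular (Y.presheaf.stalk
    y) (List.ofFn s) ∧ ∀ w : Y.presheaf.stalk y, (∃ e : ℕ, w ^ p ^ e ∈ Ideal.span ((fun z : Y.presheaf.stalk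
    y => z ^ p ^ e) '' (Ideal.span (Set.range s) : Set (Y.presheaf.stalk y)))) → w ∈ Ideal.span (Set.range
    s)) (T : Set Y) (hT : T.Finite) (hTc : ∀ x ∈ T, IsClosed ({x} : Set Y)) (hdef : ∀ x : Y, x ∈ T ↔ ¬
    (IsDomain (Y.presheaf.stalk x) ∧ ∀ d : ℕ, ringKrullDim (Y.presheaf.stalk x) = d → ∀ s : Fin d →
    Y.presheaf.stalk x, (Ideal.span (Set.range s)).radical.IsMaximal → ∀ y c : Y.presheaf.stalk x, c ≠ 0 →
    (∀ e : ℕ, c * y ^ p ^ e ∈ Ideal.span ((fun z : Y.presheaf.stalk x => z ^ p ^ e) '' (Ideal.span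
    (Set.range s) : Set (Y.presheaf.stalk x)))) → y ∈ Ideal.span (Set.range s))) (hmm : ∀ x ∈ T, (∀ (q :
    Ideal (Y.presheaf.stalk x)) [q.IsPrime], q ≠ IsLocalRing.maximalIdeal (Y.presheaf.stalk x) →
    IsRegularLocalRing (Localization.AtPrime q)) ∧ (∃ (S : Type) (_ : CommRing S) (_ : IsRegularLocalRing S)
    (_ : CharP S p) (n : ℕ) (f : S), ringKrullDim S = ((n + 1 : ℕ) : WithBot ℕ∞) ∧ f ∈
    IsLocalRing.maximalIdeal S ^ (n + 1) ∧ f ^ (p - 1) ∉ frobeniusPower p (IsLocalRing.maximalIdeal S) ∧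
    Nonempty (Y.presheaf.stalk x ≃+* S ⧸ Ideal.span {f}))) : ∃ (Y₂ : Scheme.{0}) (π : Y₂ ⟶ Y), IsProper π ∧
    IsBirational π ∧ ∀ x : Y₂, IsDomain (Y₂.presheaf.stalk x) ∧ ∀ d : ℕ, ringKrullDim (Y₂.presheaf.stalk x)
    = d → ∀ s : Fin d → Y₂.presheaf.stalk x, (Ideal.span (Set.range s)).radical.IsMaximal → ∀ y c :
    Y₂.presheaf.stalk x, c ≠ 0 → (∀ e : ℕ, c * y ^ p ^ e ∈ Ideal.span ((fun z : Y₂.presheaf.stalk x => z ^ p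
    ^ e) '' (Ideal.span (Set.range s) : Set (Y₂.presheaf.stalk x)))) → y ∈ Ideal.span (Set.range s) := by
  classical
  -- (`h₂`, rung 2 on `Y`, is part of the registered signature but not needed for the construction)
  have _h₂ := h₂
  have hp : p.Prime := Fact.out
  haveI : IsLocallyNoetherian Y := LocallyOfFiniteType.isLocallyNoetherian g
  -- points of `T` are singular points of `Y` (regular local rings are rung-3)
  have hTreg : T ⊆ (Scheme.regularLocus Y)ᶜ := fun x hx hreg => by
    haveI := Negative.charP_stalk g x
    exact (hdef x).mp hx
      (Negative.rungThree_of_isRegularLocalRing hp _ ((Scheme.mem_regularLocus x).mp hreg))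
  -- the centre: `T` with its reduced structure
  let Z : Closeds Y := ⟨T, isClosed_of_finite_of_isClosed_singleton hT hTc⟩
  let J : Y.IdealSheafData := Scheme.IdealSheafData.vanishingIdeal Z
  have hJ : J ≠ ⊥ := vanishingIdeal_ne_bot_of_subset_compl_regularLocus (Z := Z) hTreg
  have hJsupp : (J.support : Set Y) = T := Scheme.IdealSheafData.coe_support_vanishingIdeal Z
  -- the blowing up of `Y` along `J`
  obtain ⟨W, π, hπ⟩ := exists_isBlowup Y J
  haveI : IsIntegral W := hπ.isIntegral hJ
  haveI : IsProper π := hπ.isProper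
  refine ⟨W, π, inferInstance, hπ.isBirational' hJ, fun w => ?_⟩
  haveI := Negative.charP_stalk (π ≫ g) w
  by_cases hw : π w ∈ T
  · -- over a point of `T`: the stalk is a stalk of `Bl_𝔪 Spec 𝒪_{Y, π w}`, certified by S1
    obtain ⟨hiso, S, _, _, _, n, f, hdim, hmult, hF, ⟨eS⟩⟩ := hmm (π w) hw
    haveI := Negative.charP_stalk g (π w)
    have hm : maximalIdeal (Y.presheaf.stalk (π w)) ≠ ⊥ := fun h =>
      maximalIdeal_not_mem_minimalPrimes_of_not_mem_regularLocus (hTreg hw)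
        (by rw [h, IsDomain.minimalPrimes_eq_singleton_bot]; exact Set.mem_singleton _)
    have hgood := MaxMultiplicityCertificate.stub_maxMultiplicityCertificate p S n f hdim hmult hF
      (Y.presheaf.stalk (π w)) eS hm hiso
    have hst : stalkIdeal J (π w) = maximalIdeal (Y.presheaf.stalk (π w)) :=
      stalkIdeal_vanishingIdeal_of_finite (Z := Z) hT hTc hw
    obtain ⟨y, ⟨E⟩⟩ := exists_stalk_ringEquiv_affineBlowup hπ hst (w := w) rfl
    rcases MaxMultiplicityCertificate.good_of_ringEquiv p E.symm (hgood y) with hreg | ⟨-, t, htm, ht0, hregt, hcl⟩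
    · exact Negative.rungThree_of_isRegularLocalRing hp _ hreg
    · exact ⟨inferInstance,
        CertifiedModel.rungThree_of_certificate p (π ≫ g) w (Or.inr ⟨t, htm, ht0, hregt, hcl⟩)⟩
  · -- off `T`: `π` is a local isomorphism at `w`, and `𝒪_{Y, π w}` is rung-3 by `hdef`
    have hw' : π w ∉ (J.support : Set Y) := by rwa [hJsupp]
    haveI := isIso_stalkMap_of_not_mem_support hπ w hw'
    have h3 : IsDomain (Y.presheaf.stalk (π w)) ∧ ∀ d : ℕ, ringKrullDim (Y.presheaf.stalk (π w)) = d →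
        ∀ s : Fin d → Y.presheaf.stalk (π w), (Ideal.span (Set.range s)).radical.IsMaximal →
        ∀ y c : Y.presheaf.stalk (π w), c ≠ 0 → (∀ e : ℕ, c * y ^ p ^ e ∈
          Ideal.span ((fun z : Y.presheaf.stalk (π w) => z ^ p ^ e) ''
            (Ideal.span (Set.range s) : Set (Y.presheaf.stalk (π w))))) → y ∈ Ideal.span (Set.range s) := by
      by_contra h
      exact hw ((hdef (π w)).mpr h)
    exact FRationalResolution.ClauseInvariance.stub_clause_of_ringEquiv p
      (asIso (π.stalkMap w)).commRingCatIsoToRingEquiv h3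

end Summit.ResolutionOfSingularities.ResolutionOfSingularities.Theorems.FRationalModification.FiniteMaxMultDefectModel

end
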